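import Literature.AlgebraicGeometry.Resolution.SmoothEquivalenceNormalizationProofs
import Mathlib.RingTheory.Etale.Field
import Mathlib.RingTheory.Localization.Away.Basic
import HarnessLib

/-!
# Étale algebras over a normal domain, evaluated in a field: cutting down to a domain

Topic: `Literature/AlgebraicGeometry/Resolution` (valued function fields; étale charts of models).
Groundwork for the algebraization step of M. Temkin, *Inseparable local uniformization*,
J. Algebra 373 (2013) = arXiv:0804.1554v3, Thm. 3.3.1 (the common étale neighbourhood of a
terminal point is to be realized by explicit étale charts INSIDE the henselization of the valued
function field; cf. the proof of Thm. 2.4.3 (iii) there, "the connected component `Y^h_i` of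
`Y^h` which contains the preimage of `yᵢ`"): an étale algebra `S` over an integrally closed
domain `R`, together with an `R`-algebra map `S → L` to a field extending `R ⊆ L`, becomes a
SUBRING of `L` after inverting one element `s₀` with `s₀ ↦ 1`:

* `exists_eq_one_and_mul_eq_zero_of_etale` — there is `s₀ ∈ S` with `s₀ ↦ 1` killing the kernel
  of `S → L` (`x ↦ 0 ⇒ s₀ x = 0`): over the fraction field `F` of `R`, `F ⊗_R S` is a finite
  product of fields (Mathlib's `Algebra.FormallyEtale.iff_exists_algEquiv_prod`), `F ⊗_R S → L`
  factors through exactly one factor, and the corresponding idempotent, being integral over `S`,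
  comes from `S` because smooth base change commutes with integral closure (Mathlib's
  `TensorProduct.toIntegralClosure_bijective_of_smooth`, through the tree lemma
  `mem_range_of_isIntegral_tensor_fractionRing`) — PROVED;
* `injective_awayLift_of_etale` — consequently `S[1/s₀] → L` is injective: `S[1/s₀]` (still
  étale over `R`) is a subring of `L` — PROVED;
* `mem_range_of_isIntegral_of_etale` — such a subring `T ⊆ L` (étale over `R`, `T → L`
  injective) is relatively integrally closed: `z ∈ L` integral over `T` with `c z ∈ T` for a
  nonzero `c ∈ R` lies in `T` (smooth base change commutes with integral closure) — PROVED.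

All statements are [folklore] (Stacks Project, Tag 00U7-type local structure; EGA IV 18.10.16
for the normality background); no definitions, no named facts.

## Sources

* The Stacks Project, Tag 025P/033C (étale over normal is normal) and Tag 00U3 (étale algebras
  over fields are products of separable extensions), through Mathlib.
* M. Temkin, arXiv:0804.1554v3, proof of Thm. 2.4.3 (the use).
-/

noncomputable section

open TensorProduct

namespace Literature.AlgebraicGeometry.Resolution

universe u v

/-! ### A ring homomorphism from a finite product of fields to a field selects one factor -/

section PiField

variable {I : Type u} [Finite I] {Ai : I → Type u} [∀ i, Field (Ai i)] {L : Type v} [Field L]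

/-- A ring homomorphism `ψ` from a finite product of fields to a field takes the value `1` on
exactly one standard idempotent `eᵢ`, and kills every element killed by `ψ` after multiplication
by that idempotent. [folklore] -/
theorem exists_single_of_ringHom_pi [DecidableEq I] (ψ : (Π i, Ai i) →+* L) :
    ∃ i₀ : I, ψ (Pi.single i₀ 1) = 1 ∧ ∀ y : Π i, Ai i, ψ y = 0 → y * Pi.single i₀ 1 = 0 := by
  haveI := Fintype.ofFinite I
  -- some idempotent is not killed
  have hsum : ∑ i, ψ (Pi.single i (1 : Ai i)) = 1 := by
    rw [← map_sum, Finset.univ_sum_single (fun _ : I => (1 : _))]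
    exact map_one ψ
  obtain ⟨i₀, hi₀⟩ : ∃ i₀, ψ (Pi.single i₀ (1 : Ai i₀)) ≠ 0 := by
    by_contra h
    push Not at h
    rw [Finset.sum_eq_zero (fun i _ => h i)] at hsum
    exact zero_ne_one hsum
  have hidem : IsIdempotentElem (ψ (Pi.single i₀ (1 : Ai i₀))) := by
    change ψ _ * ψ _ = ψ _
    rw [← map_mul, ← Pi.single_mul, mul_one]
  have h1 : ψ (Pi.single i₀ (1 : Ai i₀)) = 1 :=
    (IsIdempotentElem.iff_eq_zero_or_one.mp hidem).resolve_left hi₀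
  refine ⟨i₀, h1, fun y hy => ?_⟩
  -- `a ↦ ψ (single i₀ a)` is a ring hom from the field `Ai i₀`, hence injective
  let ρ : Ai i₀ →+* L :=
    { toFun := fun a => ψ (Pi.single i₀ a)
      map_one' := h1
      map_mul' := fun a b => by rw [← map_mul, ← Pi.single_mul]
      map_zero' := by rw [Pi.single_zero, map_zero]
      map_add' := fun a b => by rw [← map_add, ← Pi.single_add] }
  have hρ : ρ (y i₀) = 0 := by
    change ψ (Pi.single i₀ (y i₀)) = 0
    have : Pi.single i₀ (y i₀) = y * Pi.single i₀ 1 := by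
      ext j
      by_cases hj : j = i₀
      · subst hj; simp
      · simp [Pi.single_eq_of_ne hj]
    rw [this, map_mul, hy, zero_mul]
  have hy0 : y i₀ = 0 := (map_eq_zero ρ).mp hρ
  ext j
  by_cases hj : j = i₀
  · subst hj; simp [hy0]
  · rw [Pi.mul_apply, Pi.single_eq_of_ne hj, mul_zero, Pi.zero_apply]

end PiField

/-! ### The idempotent selecting the sheet of `S → L`, and the element `s₀ ∈ S` -/

section Etale

variable {R S : Type u} [CommRing R] [IsDomain R] [IsIntegrallyClosed R] [CommRing S] [Algebra R S]
  [Algebra.Etale R S] {L : Type u} [Field L] [Algebra R L] [Algebra S L] [IsScalarTower R S L]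

/-- **Cutting an étale algebra down to the sheet of a point with values in a field.** For `S`
étale over an integrally closed domain `R` and an `R`-algebra map `S → L` to a field extending
`R ⊆ L`, there is `s₀ ∈ S` with `s₀ ↦ 1` such that `s₀ x = 0` whenever `x ↦ 0`. [folklore] -/
theorem exists_eq_one_and_mul_eq_zero_of_etale (hinj : Function.Injective (algebraMap R L)) :
    ∃ s₀ : S, algebraMap S L s₀ = 1 ∧ ∀ x : S, algebraMap S L x = 0 → s₀ * x = 0 := by
  classical
  let F := FractionRing R
  let A := F ⊗[R] S
  -- `A` is étale over the field `F`, hence a finite product of fields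
  haveI : Algebra.Etale F A := inferInstance
  obtain ⟨I, hI, Ai, hAi, hAlg, e, -⟩ :=
    (Algebra.FormallyEtale.iff_exists_algEquiv_prod F A).mp inferInstance
  -- the evaluation `A → L`
  let fF : F →ₐ[R] L := IsFractionRing.liftAlgHom (K := F) (g := Algebra.ofId R L) hinj
  let fS : S →ₐ[R] L := IsScalarTower.toAlgHom R S L
  let χ : A →ₐ[R] L := Algebra.TensorProduct.lift fF fS fun _ _ => Commute.all _ _
  have hχS : ∀ x : S, χ (Algebra.TensorProduct.includeRight x) = algebraMap S L x := fun x => by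
    change χ ((1 : F) ⊗ₜ x) = _
    rw [Algebra.TensorProduct.lift_tmul, map_one, one_mul]; rfl
  -- transport to the product and select the sheet
  let ψ : (Π i, Ai i) →+* L := (χ : A →+* L).comp (e.symm : (Π i, Ai i) →+* A)
  obtain ⟨i₀, h1, hkill⟩ := exists_single_of_ringHom_pi ψ
  let e₀ : A := e.symm (Pi.single i₀ 1)
  have he₀χ : χ e₀ = 1 := h1
  have he₀kill : ∀ z : A, χ z = 0 → z * e₀ = 0 := fun z hz => by
    have h2 := hkill (e z) (by change χ (e.symm (e z)) = 0; rwa [e.symm_apply_apply])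
    have h3 := congrArg e.symm h2
    rw [map_mul, e.symm_apply_apply, map_zero] at h3
    exact h3
  have he₀idem : e₀ * e₀ = e₀ := by
    change e.symm _ * e.symm _ = e.symm _
    rw [← map_mul, ← Pi.single_mul, mul_one]
  -- `e₀` is integral over `S`; move to `S ⊗[R] F` and use smooth base change of integral closure
  let c : A ≃ₐ[R] S ⊗[R] F := Algebra.TensorProduct.comm R F S
  have hc : ∀ x : S, c (Algebra.TensorProduct.includeRight x) = algebraMap S (S ⊗[R] F) x := fun x => by
    change c ((1 : F) ⊗ₜ x) = x ⊗ₜ 1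
    exact Algebra.TensorProduct.comm_tmul R (1 : F) x
  haveI : Nontrivial S := (algebraMap S L).domain_nontrivial
  have hint : IsIntegral S (c e₀) := by
    refine ⟨Polynomial.X ^ 2 - Polynomial.X, (Polynomial.monic_X_pow 2).sub_of_left (by
      rw [Polynomial.degree_X_pow, Polynomial.degree_X]; norm_num), ?_⟩
    simp only [Polynomial.eval₂_sub, Polynomial.eval₂_X_pow, Polynomial.eval₂_X]
    rw [sq, ← map_mul, he₀idem, sub_self]
  obtain ⟨s₀, hs₀⟩ := mem_range_of_isIntegral_tensor_fractionRing (P := R) (S := S) (Q := F) (c e₀) hint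
  -- `includeRight s₀ = e₀`
  have hs₀' : Algebra.TensorProduct.includeRight (R := R) (A := F) s₀ = e₀ := by
    apply c.injective
    rw [hc]
    exact hs₀
  refine ⟨s₀, ?_, fun x hx => ?_⟩
  · rw [← hχS, hs₀', he₀χ]
  · -- `includeRight (s₀ x) = (includeRight x) e₀ = 0`, and `includeRight` is injective (flatness)
    have h4 : Algebra.TensorProduct.includeRight (R := R) (A := F) (s₀ * x) = 0 := by
      rw [map_mul, hs₀', mul_comm]
      exact he₀kill _ (by rw [hχS]; exact hx)
    have hinjF : Function.Injective (algebraMap R F) := IsFractionRing.injective R F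
    have hincl : Function.Injective (algebraMap S (S ⊗[R] F)) :=
      Algebra.TensorProduct.includeLeft_injective (S := R) hinjF
    apply hincl
    rw [map_zero, ← hc, h4, map_zero]

/-- **The étale chart becomes a subring of the field after inverting `s₀`**: for `s₀` as in
`exists_eq_one_and_mul_eq_zero_of_etale`, the induced map `S[1/s₀] → L` is injective.
[folklore] -/
theorem injective_awayLift_of_etale {s₀ : S} (h1 : algebraMap S L s₀ = 1)
    (hkill : ∀ x : S, algebraMap S L x = 0 → s₀ * x = 0)
    (Sₛ : Type*) [CommRing Sₛ] [Algebra S Sₛ] [IsLocalization.Away s₀ Sₛ] :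
    Function.Injective (IsLocalization.Away.lift (S := Sₛ) s₀ (g := algebraMap S L)
      (by rw [h1]; exact isUnit_one)) := by
  set φ := IsLocalization.Away.lift (S := Sₛ) s₀ (g := algebraMap S L) (by rw [h1]; exact isUnit_one)
  refine (injective_iff_map_eq_zero φ).mpr fun z hz => ?_
  obtain ⟨⟨x, y⟩, rfl⟩ := IsLocalization.mk'_surjective (Submonoid.powers s₀) z
  -- `φ (x / y) = 0` forces `x ↦ 0`
  have hx : algebraMap S L x = 0 := by
    have h2 : φ (IsLocalization.mk' Sₛ x y) * φ (algebraMap S Sₛ y) = φ (algebraMap S Sₛ x) := by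
      rw [← map_mul, IsLocalization.mk'_spec]
    rw [hz, zero_mul, IsLocalization.Away.lift_eq] at h2
    exact h2.symm
  rw [IsLocalization.mk'_eq_zero_iff]
  exact ⟨⟨s₀, Submonoid.mem_powers s₀⟩, hkill x hx⟩

end Etale

/-! ### Normality of the chart inside the field -/

section Normal

variable {R T L : Type u} [CommRing R] [IsDomain R] [IsIntegrallyClosed R] [CommRing T] [Algebra R T]
  [Algebra.Etale R T] [Field L] [Algebra R L] [Algebra T L] [IsScalarTower R T L]

/-- **An étale chart realized in a field is relatively integrally closed**: for `T` étale over an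
integrally closed domain `R` with `T → L` INJECTIVE (a subring of the field `L` extending
`R ⊆ L`), every `z ∈ L` which is integral over `T` and lies in `T·Frac(R)` (i.e. `c z ∈ T` for
some nonzero `c ∈ R`) lies in `T` (smooth base change commutes with integral closure).
[folklore] -/
theorem mem_range_of_isIntegral_of_etale (hR : Function.Injective (algebraMap R L))
    (hT : Function.Injective (algebraMap T L)) {z : L} (hz : IsIntegral T z)
    {c : R} (hc : c ≠ 0) {t : T} (hzt : algebraMap R L c * z = algebraMap T L t) :
    z ∈ (algebraMap T L).range := by
  let F := FractionRing R
  let TF := T ⊗[R] F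
  haveI : IsLocalization (Algebra.algebraMapSubmonoid T (nonZeroDivisors R)) TF :=
    IsLocalization.tensor F (nonZeroDivisors R)
  -- the evaluation `T ⊗ F → L` and its injectivity
  let Λ : TF →ₐ[R] L := Algebra.TensorProduct.lift (IsScalarTower.toAlgHom R T L)
    (IsFractionRing.liftAlgHom (K := F) (g := Algebra.ofId R L) hR) fun _ _ => Commute.all _ _
  have hΛT : ∀ x : T, Λ (algebraMap T TF x) = algebraMap T L x := fun x => by
    change Λ (x ⊗ₜ (1 : F)) = _
    rw [Algebra.TensorProduct.lift_tmul, map_one, mul_one]; rfl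
  have hΛinj : Function.Injective Λ := by
    refine (injective_iff_map_eq_zero Λ).mpr fun w hw => ?_
    obtain ⟨⟨x, y⟩, rfl⟩ := IsLocalization.mk'_surjective (Algebra.algebraMapSubmonoid T (nonZeroDivisors R)) w
    have h2 : Λ (IsLocalization.mk' TF x y) * Λ (algebraMap T TF y) = Λ (algebraMap T TF x) := by
      rw [← map_mul, IsLocalization.mk'_spec]
    rw [hw, zero_mul, hΛT] at h2
    have hx : x = 0 := hT (by rw [map_zero]; exact h2.symm)
    change IsLocalization.mk' TF x y = 0
    rw [hx, IsLocalization.mk'_zero]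
  -- the element `w = t / c` of `T ⊗ F` over `z`
  have hcT : algebraMap R T c ∈ Algebra.algebraMapSubmonoid T (nonZeroDivisors R) :=
    ⟨c, mem_nonZeroDivisors_of_ne_zero hc, rfl⟩
  let w : TF := IsLocalization.mk' TF t ⟨algebraMap R T c, hcT⟩
  have hΛc : Λ (algebraMap T TF (algebraMap R T c)) = algebraMap R L c := by
    rw [hΛT, ← IsScalarTower.algebraMap_apply]
  have hwz : Λ w = z := by
    have h2 : Λ w * Λ (algebraMap T TF (algebraMap R T c)) = Λ (algebraMap T TF t) := by
      rw [← map_mul]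
      exact congrArg Λ (IsLocalization.mk'_spec TF t ⟨algebraMap R T c, hcT⟩)
    rw [hΛc, hΛT, ← hzt, mul_comm] at h2
    exact mul_left_cancel₀ ((map_ne_zero_iff _ hR).mpr hc) h2
  -- `w` is integral over `T` (pull the equation of `z` back along the injective `Λ`)
  have hwint : IsIntegral T w := by
    obtain ⟨q, hqm, hq⟩ := hz
    refine ⟨q, hqm, hΛinj ?_⟩
    rw [map_zero, show Λ (Polynomial.eval₂ (algebraMap T TF) w q) =
      (Λ : TF →+* L) (Polynomial.eval₂ (algebraMap T TF) w q) from rfl, Polynomial.hom_eval₂,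
      show ((Λ : TF →+* L).comp (algebraMap T TF)) = algebraMap T L from RingHom.ext fun x => hΛT x]
    change Polynomial.eval₂ (algebraMap T L) (Λ w) q = 0
    rw [hwz]
    exact hq
  obtain ⟨t₀, ht₀⟩ := mem_range_of_isIntegral_tensor_fractionRing (P := R) (S := T) (Q := F) w hwint
  exact ⟨t₀, by rw [← hΛT, ht₀, hwz]⟩

end Normal

end Literature.AlgebraicGeometry.Resolution
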